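import Summits.CriticalPhenomena.PercolationContinuityZ3.Theorems.PercNearOneGluingNoHeavyQuantDIBStarFloorSplitInductionMid
import Summits.CriticalPhenomena.PercolationContinuityZ3.Theorems.PercNearOneGluingNoHeavyQuantOneBig
import Literature.Combinatorics.StablePolynomials.GurvitsCapacityUnivariate
import HarnessLib

/-!
# QUANT lane R8, Conjecture DIB\* — T-DIB REDUCED TO ONE CLOSED-FORM REAL INEQUALITY (`COCert`):
# the largest-blob split certified by Cantelli at the upper level and exact-∨ ⊗ Cantelli-dust at the lower level

builds on p205010 (kernel theorem, internal audit signed; external expert review pending)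

Statement + support file (`--supports stmt-CriticalPhenomena-4575`), QUANT lane typer seat prim-quant-stmt (gen 21).  ONE `Prop`
definition (the `@[conjecture]` `COCert`), theorems otherwise; no sorries, standard axioms.

CONTEXT.  After `…QuantDIBStarHighFloors` (p279119: `DIBStar x` for `x ≥ 7/8`) and `DIBStar.of_le_half`, Conjecture DIB\* is open exactly
on the floors `(1/2, 7/8)` (`dibStar_iff_mid_floors`, p280585).  The seat's exact census (kit j133883: the 21 323 residual grid instances
of lead g19, 0 failures, min margin 0.237) and adversarial map (STATEMENTS §W addendum: margin ≥ 0.17 in every band of `(1/2, 7/8)`;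
inductive rows and transport idle there) single out ONE certificate: split at a LARGEST blob `k₀` (size `b`, gate `p`;
`P = p·T₁ + (1−p)·T₀` by `term_cond`), bound `T₀ = P(N_R ≥ j+1)` below by Cantelli / Markov on the rest `R`, and `T₁ = P(N_R ≥ ℓ+1)`
(`ℓ = j − b`) by the EXACT factorisation over the rest blobs `G` of size `≥ ℓ + 1` (`one_sub_term_eq_giants`) times Cantelli for the
dust `D` (sizes `≤ ℓ`, so `V_D ≤ ℓ·Σ_D a g(1−g)`).  In the aggregates of `G` and `D` (totals, means, credits, `Σ a g(1−g)`, the count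
`n = |G|` and `Q = ∏_G (1−g)`, bounded by AM–GM through the credit and the mean of `G`) this is the closed-form inequality `COCert` below;
its continuum relaxation was minimised numerically over the nine free variables (seat folder work/explore/agg3.py, agg4.py: grid of
23 679 cells in `(x, p, b/j, n)` × 1 500 inner searches; 0 negatives, minimum normalised margin 0.113 at `x ≈ 0.68`, `p = x`, `b = j`,
`n = 2`, no dust — the 'three tied blobs at the floor' family).

THIS FILE (part 1 of 2): * `Quant.IndepBlob.COCert` (`@[conjecture]`) — THE REAL INEQUALITY (floors `1/2 < x < 7/8`);
* the two kernel TERM rules it is discharged by: `RootDec.term_ge_of_or_cantelliDust` (lower level: exact-∨ over the giants ⊗ Cantelli for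
  the dust with `V_D ≤ ℓ·s2_D`) and `RootDec.term_ge_of_restMenu` (upper level: 0 | Markov | Cantelli with a variance bound);
  `cantelli_frac_mono`, `IndepBlob.creditRate_nonneg`.
Part 2 (`…QuantCOCertReduction`): `RootDec.row_of_coCert` and **`IndepBlob.dibStar_of_coCert : COCert → ∀ x < 1, DIBStar x`** —
T-DIB is implied by ONE explicit inequality in nine real variables with numerical margin 0.11.
[this work]; the gluing rows served [cite: KozmaNitzan2024, Conjecture 3 (p. 15)]; product weights [cite: Grimmett1999, §1.3 p. 10];
AM–GM [cite: HardyLittlewoodPolya1952, Thm. 9] via `Literature.Combinatorics.StablePolynomials.Gurvits.finset_prod_le_arith_mean_pow`.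
-/

namespace Summit.CriticalPhenomena.PercolationContinuityZ3.Theorems

namespace Quant

open Finset

namespace IndepBlob

/-- **CONJECTURE — THE CO CERTIFICATE (closed-form real inequality; typer g21).**  Data: floor `x ∈ (1/2, 7/8)`; the largest blob
(`p` = gate `≥ x²`, `b` = size, `b ≤ j < 2x·b`); the other blobs of size `≥ j − b + 1` ('G': count `n`, total `AG ≤ n·b`, mean `mG`,
credit `CG`, `s2G = Σ a g(1−g)`, and `Q = ∏_G (1 − g)` with its two AM–GM bounds); the blobs of size `≤ j − b` ('D': `AD, mD, CD, s2D`;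
`AD = 0` when `b = j`); the per-part aggregate constraints of `…QuantOneBig` (`phi_le_gate`, `gate_ge_floorSq_add`, `gate_var_le`); the
credit hypothesis split at the big.  Conclusion: menu items `z₁` (lower level `ℓ = j − b`: `1 − Q`, or `1 − Q·Cantelli_D` with
`V_D ≤ ℓ·s2D`) and `z₀` (level `j`: 0 | Markov | Cantelli with `V_R ≤ b·s2G + ℓ·s2D`) with `x ≤ p·z₁ + (1 − p)·z₀`.
Numerically: minimum normalised margin 0.113 over the continuum relaxation (agg4.py).  `row_of_coCert` / `dibStar_of_coCert` turn it
into Conjecture DIB\* at every floor.  builds on p205010 (kernel theorem, internal audit signed; external expert review pending).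
[this work] [status: open] -/
@[conjecture] def COCert : Prop :=
  ∀ (x p Q AG mG CG s2G AD mD CD s2D : ℝ) (j b n : ℕ),
    1 / 2 < x → x < 7 / 8 → x ^ 2 ≤ p → p ≤ 1 →
    b ≤ j → (j : ℝ) < 2 * x * b →
    (2 * j : ℝ) < (b : ℝ) * (if x ≤ p then p else (p - x ^ 2) / (1 - x)) + CG + CD →
    (n : ℝ) * (((j - b : ℕ) : ℝ) + 1) ≤ AG → AG ≤ (n : ℝ) * b →
    0 ≤ CG → CG ≤ mG → x ^ 2 * AG + (1 - x) * CG ≤ mG → mG ≤ AG →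
    0 ≤ s2G → s2G ≤ (1 - x) * (2 * mG - CG) → s2G ≤ mG → s2G ≤ AG - mG →
    0 ≤ Q → Q ≤ 1 → (n = 0 → Q = 1) →
    (0 < n → Q ≤ (1 - x ^ 2 - (1 - x) * CG / ((b : ℝ) * n)) ^ n) →
    (0 < n → Q ≤ (1 - mG / ((b : ℝ) * n)) ^ n) →
    0 ≤ CD → CD ≤ mD → x ^ 2 * AD + (1 - x) * CD ≤ mD → mD ≤ AD →
    0 ≤ s2D → s2D ≤ (1 - x) * (2 * mD - CD) → s2D ≤ mD → s2D ≤ AD - mD →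
    (b = j → AD = 0) →
    ∃ z₁ z₀ : ℝ,
      (z₁ ≤ 1 - Q ∨ (((j - b : ℕ) : ℝ) < mD ∧
          z₁ ≤ 1 - Q * ((((j - b : ℕ) : ℝ) * s2D) / (((j - b : ℕ) : ℝ) * s2D + (mD - ((j - b : ℕ) : ℝ)) ^ 2)))) ∧
      (z₀ ≤ 0 ∨ ((j : ℝ) < AG + AD ∧ z₀ ≤ 1 - (AG + AD - (mG + mD)) / (AG + AD - j)) ∨
        ((j : ℝ) < mG + mD ∧ z₀ ≤ 1 - ((b : ℝ) * s2G + ((j - b : ℕ) : ℝ) * s2D) /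
          (((b : ℝ) * s2G + ((j - b : ℕ) : ℝ) * s2D) + (mG + mD - j) ^ 2))) ∧
      x ≤ p * z₁ + (1 - p) * z₀

/-- The credit rate is non-negative on gates `≥ x²` (`0 ≤ x < 1`). [this work] -/
theorem creditRate_nonneg (x g : ℝ) (hx0 : 0 ≤ x) (hx1 : x < 1) (hg : x ^ 2 ≤ g) :
    0 ≤ (if x ≤ g then g else (g - x ^ 2) / (1 - x)) := by
  split_ifs with h
  · exact hx0.trans h
  · exact div_nonneg (by linarith) (by linarith)

end IndepBlob

namespace RootDec

variable {κ : Type} [Fintype κ] [DecidableEq κ]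

/-- product-Bernoulli weight of the set `W` of open blobs (as in `…QuantRootReduction`) -/
local notation3 "wt[" g ", " W "]" => ∏ k, (if k ∈ (W : Finset κ) then (g : κ → ℝ) k else 1 - (g : κ → ℝ) k)

/-- the TERM tail `P(s + Σ_{k open} a k ≥ j+1)` (as in `…QuantRootReduction`) -/
local notation3 "TERM[" s ", " a ", " g ", " j "]" =>
  ∑ W : Finset κ, wt[g, W] * (if (j : ℕ) + 1 ≤ (s : ℕ) + ∑ k ∈ W, (a : κ → ℕ) k then (1 : ℝ) else 0)

/-- Monotonicity of the Cantelli expression in the variance: `0 ≤ V ≤ V'`, `0 < E` ⟹ `V/(V+E) ≤ V'/(V'+E)`. [this work] -/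
theorem cantelli_frac_mono (V V' E : ℝ) (hV : 0 ≤ V) (hVV : V ≤ V') (hE : 0 < E) : V / (V + E) ≤ V' / (V' + E) := by
  rw [div_le_div_iff₀ (by linarith) (by linarith)]
  nlinarith

/-- **Lower level: exact-∨ over the giants ⊗ Cantelli for the dust, as a TERM rule.**  Sure part `b ≤ j`, gates in `[0,1]`, a finset
`G` of giants (`j + 1 ≤ b + a i` on `G`), the other blobs of size `≤ j − b`; with `a'' = a` off `G` and `0` on `G`, `mD = Σ a'' g`,
`s2D = Σ a'' g(1−g)`: any `z ≤ 1 − ∏_G(1−g)` or (`j − b < mD` and) `z ≤ 1 − ∏_G(1−g)·(ℓ·s2D/(ℓ·s2D + (mD − ℓ)²))`, `ℓ = j − b`,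
satisfies `z ≤ TERM[b, a, g, j]` (`term_ge_of_giants_smalls` + `term_ge_of_cantelli` + `V_D ≤ ℓ·s2D`). [this work] -/
theorem term_ge_of_or_cantelliDust (b : ℕ) (a : κ → ℕ) (g : κ → ℝ) (j : ℕ) (hg : ∀ i, 0 ≤ g i ∧ g i ≤ 1) (hbj : b ≤ j)
    (G : Finset κ) (hG : ∀ i ∈ G, j + 1 ≤ b + a i) (hD : ∀ i, i ∉ G → a i ≤ j - b) (z : ℝ)
    (hz : z ≤ 1 - ∏ i ∈ G, (1 - g i) ∨
      (((j - b : ℕ) : ℝ) < ∑ i, ((if i ∈ G then 0 else a i : ℕ) : ℝ) * g i ∧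
        z ≤ 1 - (∏ i ∈ G, (1 - g i)) *
          ((((j - b : ℕ) : ℝ) * ∑ i, ((if i ∈ G then 0 else a i : ℕ) : ℝ) * g i * (1 - g i)) /
            (((j - b : ℕ) : ℝ) * (∑ i, ((if i ∈ G then 0 else a i : ℕ) : ℝ) * g i * (1 - g i)) +
              ((∑ i, ((if i ∈ G then 0 else a i : ℕ) : ℝ) * g i) - ((j - b : ℕ) : ℝ)) ^ 2)))) :
    z ≤ TERM[b, a, g, j] := by
  set a'' : κ → ℕ := fun i => if i ∈ G then 0 else a i with ha''
  have ha''le : ∀ i, a'' i ≤ j - b := by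
    intro i; simp only [ha'']
    split_ifs with hi
    · exact Nat.zero_le _
    · exact hD i hi
  rcases hz with h | ⟨hm, h⟩
  · refine term_ge_of_giants_smalls b a g j hg G hG z 0 ?_ (by rw [sub_zero, mul_one]; exact h)
    exact term_nonneg b a'' g j hg
  · have hcant := term_ge_of_cantelli b a'' g j hg hbj hm
    set V'' : ℝ := ∑ i, (a'' i : ℝ) ^ 2 * g i * (1 - g i) with hV''def
    set mD : ℝ := ∑ i, (a'' i : ℝ) * g i with hmD
    set s2D : ℝ := ∑ i, (a'' i : ℝ) * g i * (1 - g i) with hs2D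
    set E : ℝ := (mD - ((j - b : ℕ) : ℝ)) ^ 2 with hE
    have hE0 : 0 < E := by rw [hE]; exact pow_pos (by linarith) 2
    have hV''0 : 0 ≤ V'' := Finset.sum_nonneg fun i _ => by
      rw [mul_assoc]; exact mul_nonneg (sq_nonneg _) (mul_nonneg (hg i).1 (sub_nonneg.2 (hg i).2))
    have hV'' : V'' ≤ ((j - b : ℕ) : ℝ) * s2D := by
      rw [hV''def, hs2D, Finset.mul_sum]
      refine Finset.sum_le_sum fun i _ => ?_
      have hgg : 0 ≤ g i * (1 - g i) := mul_nonneg (hg i).1 (sub_nonneg.2 (hg i).2)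
      have h1 : (a'' i : ℝ) ≤ ((j - b : ℕ) : ℝ) := by exact_mod_cast ha''le i
      have h2 := mul_le_mul_of_nonneg_right h1 (mul_nonneg (Nat.cast_nonneg (a'' i)) hgg)
      calc (a'' i : ℝ) ^ 2 * g i * (1 - g i) = (a'' i : ℝ) * ((a'' i : ℝ) * (g i * (1 - g i))) := by ring
        _ ≤ ((j - b : ℕ) : ℝ) * ((a'' i : ℝ) * (g i * (1 - g i))) := h2
        _ = ((j - b : ℕ) : ℝ) * ((a'' i : ℝ) * g i * (1 - g i)) := by ring
    have hmono := cantelli_frac_mono V'' (((j - b : ℕ) : ℝ) * s2D) E hV''0 hV'' hE0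
    have hP : 0 ≤ ∏ i ∈ G, (1 - g i) := Finset.prod_nonneg fun i _ => sub_nonneg.2 (hg i).2
    have hw : 1 - (((j - b : ℕ) : ℝ) * s2D) / (((j - b : ℕ) : ℝ) * s2D + E) ≤ TERM[b, a'', g, j] := by linarith
    refine term_ge_of_giants_smalls b a g j hg G hG z _ hw ?_
    have e1 : 1 - (1 - (((j - b : ℕ) : ℝ) * s2D) / (((j - b : ℕ) : ℝ) * s2D + E)) =
        (((j - b : ℕ) : ℝ) * s2D) / (((j - b : ℕ) : ℝ) * s2D + E) := by ring
    rw [e1]; exact h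

/-- **Upper level: 0 | Markov | Cantelli with a variance BOUND, as a TERM rule** (no sure part). [this work] -/
theorem term_ge_of_restMenu (a : κ → ℕ) (g : κ → ℝ) (j : ℕ) (hg : ∀ i, 0 ≤ g i ∧ g i ≤ 1) (VB : ℝ)
    (hVB : ∑ i, (a i : ℝ) ^ 2 * g i * (1 - g i) ≤ VB) (z : ℝ)
    (hz : z ≤ 0 ∨ ((j : ℝ) < ∑ i, (a i : ℝ) ∧ z ≤ 1 - ((∑ i, (a i : ℝ)) - ∑ i, (a i : ℝ) * g i) / ((∑ i, (a i : ℝ)) - j)) ∨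
      ((j : ℝ) < ∑ i, (a i : ℝ) * g i ∧ z ≤ 1 - VB / (VB + ((∑ i, (a i : ℝ) * g i) - j) ^ 2))) :
    z ≤ TERM[0, a, g, j] := by
  rcases hz with h | ⟨hA, h⟩ | ⟨hm, h⟩
  · exact h.trans (term_nonneg 0 a g j hg)
  · have hA' : ((j - 0 : ℕ) : ℝ) < ∑ i, (a i : ℝ) := by rw [Nat.sub_zero]; exact hA
    have hmk := term_ge_of_markov 0 a g j hg (Nat.zero_le j) hA'
    rw [Nat.sub_zero] at hmk
    refine h.trans (le_trans (le_of_eq ?_) hmk)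
    have hne : (∑ i, (a i : ℝ)) - (j : ℝ) ≠ 0 := by linarith
    field_simp
    ring
  · have hm' : ((j - 0 : ℕ) : ℝ) < ∑ i, (a i : ℝ) * g i := by rw [Nat.sub_zero]; exact hm
    have hcant := term_ge_of_cantelli 0 a g j hg (Nat.zero_le j) hm'
    rw [Nat.sub_zero] at hcant
    set V' : ℝ := ∑ i, (a i : ℝ) ^ 2 * g i * (1 - g i) with hV'def
    set E : ℝ := ((∑ i, (a i : ℝ) * g i) - j) ^ 2 with hE
    have hE0 : 0 < E := by rw [hE]; exact pow_pos (by linarith) 2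
    have hV'0 : 0 ≤ V' := Finset.sum_nonneg fun i _ => by
      rw [mul_assoc]; exact mul_nonneg (sq_nonneg _) (mul_nonneg (hg i).1 (sub_nonneg.2 (hg i).2))
    have hmono := cantelli_frac_mono V' VB E hV'0 hVB hE0
    linarith

end RootDec

end Quant

end Summit.CriticalPhenomena.PercolationContinuityZ3.Theorems
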